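import Mathlib
import HarnessLib
import Summits.HubbardSuperconductivity.HubbardSuperconductivity.Theses.KLProgramme
import Literature.Analysis.Complex.VitaliConvergence
import Literature.MathematicalPhysics.QuantumLattice.HubbardTorusTwoPointSmallCoupling
import Literature.MathematicalPhysics.QuantumLattice.HubbardGaugeBound
import Literature.MathematicalPhysics.QuantumLattice.DysonOrderedIntegral
import Summits.HubbardSuperconductivity.HubbardSuperconductivity.Theorems.KLProgrammeH10TwoPointLimitMatsubaraExtension

/-!
# Route `KLProgramme` — crux K1 `H10TwoPointLimit` (stmt-HubbardSuperconductivity-19938): the Vitali line with the analytic input in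
# the SHAPE OF THE TREE'S R0 CORE — agreement with the two-point function only at SMALL real couplings `0 < |U| < ρ_L`

Seat leafhand-hubbard-klprogramme-2 (K1 lead, 2026-08-30), continuation of `…Theorems.KLProgrammeH10TwoPointLimitVitaliLine` (p794110;
not imported — this module depends on the route file only directly, theses-cone hygiene).
There the holomorphic extensions `G_L` on the connected domain `Ω ∋ 0` are asked to agree with `U ↦ ⟨c†_{xσ} c_{yσ'}⟩_{β,L,U,μ}` at EVERY
real point of `Ω`.  An engine run at complex coupling (like the tree's R0 core `…H10RungBetaUCorner.R0_core`, a Grassmann representation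
bridged to the trace ratio by the Matsubara limit) naturally certifies the agreement only for SMALL non-zero real couplings
`0 < |U| < ρ_L`, with `ρ_L` depending on the volume.  This file removes the difference by the one-dimensional identity theorem:

* `exists_analyticAt_extension_hubbardThermalTwoPoint` — at finite volume the two-point function is the real trace of a function analytic
  at every REAL coupling: `u ↦ tr(e^{-β(H₀ + uV)} c†c)/tr e^{-β(H₀ + uV)}` with the affine decomposition
  `H_L(1,U) - μN = H_L(1,0) - μN + U·Σ_x n_{x↑}n_{x↓}` (`hamiltonianWith_eq_dGamma_add_smul`) and `Z > 0` at real coupling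
  (`isHermitian_hamiltonianWith`, `partitionFn_pos`);
* `eqOn_segment_of_agree_near_zero` — a holomorphic `G` on an open `Ω` containing the real SEGMENT `[0, U]` that agrees with such a real
  trace at `0 < t < ρ` agrees with it on the whole segment (identity theorem for real-analytic functions on the preconnected `Icc 0 U`);
* `tendsto_hubbardThermalTwoPoint_of_connected_extension_nearZero` — hence the Vitali theorem of the parent file with the agreement
  hypothesis weakened to R0-shape `∀ L ≥ L₀, ∃ ρ > 0, ∀ t, 0 < |t| → |t| < ρ → G_L t = ⟨…⟩_{β,L,t,μ}` and the geometric hypothesis that `Ω`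
  contains the segment `[0, U]` of the target coupling;
* **`H10TwoPointLimit_of_complexSausage_nearZero`**, `leaf_of_complexSausage_nearZero` — K1 and the rung-R2d leaf from that input.

Everything here is PROVED; no definition, no named fact; nothing about the Hubbard model is asserted beyond the CLOSED theorems cited.
References: BGM 2006 [cite: BenfattoGiulianiMastropietro2006, Thm 1.1, §1 (finite volume), §2.2 footnote 1]; Vitali–Porter [folklore].
-/

noncomputable section

namespace Summit.HubbardSuperconductivity.HubbardSuperconductivity.Theorems.H10VitaliLine

set_option linter.dupNamespace false -- summit = problem name (single-conjunct summit), D-0017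

open Filter Set Metric Topology Complex
open scoped Matrix.Norms.L2Operator ComplexOrder
open Literature.MathematicalPhysics.QuantumLattice Literature.Probability.LatticeModels

/-! ## §1 The finite-volume two-point function is the real trace of a function analytic at every real coupling -/

/-- **Analytic extension in the coupling at finite volume**: for every `β, μ, L`, sites and spins there is `E : ℂ → ℂ`, analytic (over `ℂ`)
at every REAL point, with `E t = ⟨c†_{xσ} c_{yσ'}⟩_{β,L,t,μ}` for all real `t` (for `L = 0` the junk value `0`; otherwise the Gibbs ratio
of the affine family `H₀ + u·V`, `V = Σ_x n_{x↑} n_{x↓}`, whose partition function is positive at real coupling).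
[cite: BenfattoGiulianiMastropietro2006, §1] -/
theorem exists_analyticAt_extension_hubbardThermalTwoPoint (β μ : ℝ) (L : ℕ) (x y : Site 2) (σ σ' : Fin 2) :
    ∃ E : ℂ → ℂ, (∀ t : ℝ, AnalyticAt ℂ E (t : ℂ)) ∧ ∀ t : ℝ, E (t : ℂ) = hubbardThermalTwoPoint β t μ L x y σ σ' := by
  by_cases hL : L = 0
  · exact ⟨fun _ => 0, fun _ => analyticAt_const, fun t => by simp [hubbardThermalTwoPoint, hL]⟩
  · haveI : NeZero L := ⟨hL⟩
    -- the affine decomposition `H(t) = H(0) + t • V`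
    set V : Matrix (Finset (Orb (FermionTorus 2 L))) (Finset (Orb (FermionTorus 2 L))) ℂ :=
      ∑ z : FermionTorus 2 L, creation (orb z 0) * annihilation (orb z 0) * (creation (orb z 1) * annihilation (orb z 1)) with hV
    set H₀ : Matrix (Finset (Orb (FermionTorus 2 L))) (Finset (Orb (FermionTorus 2 L))) ℂ := hubbardTorusWith 2 L 1 0 μ with hH₀
    have hdec : ∀ t : ℝ, hubbardTorusWith 2 L 1 t μ = H₀ + (t : ℂ) • V := by
      intro t
      change hamiltonianWith (fermionTorusGraph 2 L) 1 t μ = hamiltonianWith (fermionTorusGraph 2 L) 1 0 μ + _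
      rw [hamiltonianWith_eq_dGamma_add_smul, hamiltonianWith_eq_dGamma_add_smul]
      simp [hV]
    set A : Matrix (Finset (Orb (FermionTorus 2 L))) (Finset (Orb (FermionTorus 2 L))) ℂ :=
      creation (orb (FermionTorus.ofTorusSite (Torus.proj L x)) σ) with hA
    set B : Matrix (Finset (Orb (FermionTorus 2 L))) (Finset (Orb (FermionTorus 2 L))) ℂ :=
      annihilation (orb (FermionTorus.ofTorusSite (Torus.proj L y)) σ') with hB
    refine ⟨fun u => Matrix.thermalCorr β (H₀ + u • V) A B, fun t => ?_, fun t => ?_⟩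
    · -- analyticity at the real coupling `t`: exp of an affine family, trace, and `Z(t) > 0`
      have haff : AnalyticAt ℂ (fun u : ℂ => -(β : ℂ) • (H₀ + u • V)) (t : ℂ) :=
        (analyticAt_const (v := -(β : ℂ))).smul (analyticAt_const.add (analyticAt_id.smul analyticAt_const))
      have hexp : AnalyticAt ℂ (fun u : ℂ => Matrix.gibbsWeight β (H₀ + u • V)) (t : ℂ) := by
        unfold Matrix.gibbsWeight
        exact (NormedSpace.exp_analytic _).comp haff
      have htr : ∀ C : Matrix (Finset (Orb (FermionTorus 2 L))) (Finset (Orb (FermionTorus 2 L))) ℂ,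
          AnalyticAt ℂ (fun u : ℂ => (Matrix.gibbsWeight β (H₀ + u • V) * C).trace) (t : ℂ) := by
        intro C
        have h1 : AnalyticAt ℂ (fun u : ℂ => Matrix.gibbsWeight β (H₀ + u • V) * C) (t : ℂ) :=
          hexp.mul analyticAt_const
        set Λtr := (Matrix.traceLinearMap (Finset (Orb (FermionTorus 2 L))) ℂ ℂ).toContinuousLinearMap with hΛtr
        have h2 : AnalyticAt ℂ (⇑Λtr ∘ fun u : ℂ => Matrix.gibbsWeight β (H₀ + u • V) * C) (t : ℂ) :=
          (Λtr.analyticAt _).comp h1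
        refine h2.congr (Eventually.of_forall fun u => ?_)
        simp [hΛtr]
      have hZan : AnalyticAt ℂ (fun u : ℂ => Matrix.partitionFn β (H₀ + u • V)) (t : ℂ) := by
        have h := htr 1
        simp only [mul_one] at h
        exact h
      have hZ : Matrix.partitionFn β (H₀ + (t : ℂ) • V) ≠ 0 := by
        rw [← hdec t]
        exact (Matrix.partitionFn_pos β (isHermitian_hamiltonianWith (fermionTorusGraph 2 L) 1 t μ)).ne'
      have h := (hZan.inv hZ).mul (htr (A * B))
      refine h.congr (Eventually.of_forall fun u => ?_)
      simp only [Pi.mul_apply, Pi.inv_apply, Matrix.thermalCorr, Matrix.gibbsState_apply]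
    · -- agreement at real coupling
      simp only [hubbardThermalTwoPoint, hL, ↓reduceDIte]
      rw [hdec t]

/-! ## §2 Agreement near `0` spreads along the real segment (identity theorem) -/

/-- **Agreement near zero ⟹ agreement on the segment**: `Ω` open, `G` complex differentiable on `Ω`, `E` analytic at every real point,
`G t = E t` for `0 < |t| < ρ`, and the real segment `[0, U]` (`U > 0`) inside `Ω` ⟹ `G t = E t` for all `t ∈ [0, U]`.
[folklore: identity theorem on a real interval] -/
theorem eqOn_segment_of_agree_near_zero {Ω : Set ℂ} (hΩ : IsOpen Ω) {G E : ℂ → ℂ} (hG : DifferentiableOn ℂ G Ω)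
    (hE : ∀ t : ℝ, AnalyticAt ℂ E (t : ℂ)) {ρ : ℝ} (hρ : 0 < ρ)
    (hagree : ∀ t : ℝ, 0 < |t| → |t| < ρ → G (t : ℂ) = E (t : ℂ)) {U : ℝ} (hU : 0 < U)
    (hseg : ∀ t ∈ Icc (0 : ℝ) U, ((t : ℝ) : ℂ) ∈ Ω) : ∀ t ∈ Icc (0 : ℝ) U, G (t : ℂ) = E (t : ℂ) := by
  set f : ℝ → ℂ := fun t => G (t : ℂ) - E (t : ℂ) with hf_def
  have hf : AnalyticOnNhd ℝ f (Icc 0 U) := by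
    intro t ht
    have hGt : AnalyticAt ℂ G (t : ℂ) := hG.analyticAt (hΩ.mem_nhds (hseg t ht))
    have h1 : AnalyticAt ℝ (fun s : ℝ => G (s : ℂ)) t :=
      (hGt.restrictScalars (𝕜 := ℝ)).comp (Complex.ofRealCLM.analyticAt t)
    have h2 : AnalyticAt ℝ (fun s : ℝ => E (s : ℂ)) t :=
      ((hE t).restrictScalars (𝕜 := ℝ)).comp (Complex.ofRealCLM.analyticAt t)
    exact h1.sub h2
  set z₀ : ℝ := min (ρ / 2) U with hz₀_def
  have hz₀pos : 0 < z₀ := lt_min (by positivity) hU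
  have hz₀ρ : z₀ < ρ := (min_le_left _ _).trans_lt (by linarith)
  have hz₀U : z₀ ∈ Icc (0 : ℝ) U := ⟨hz₀pos.le, min_le_right _ _⟩
  have hev : f =ᶠ[𝓝 z₀] 0 := by
    have hmem : Ioo (0 : ℝ) ρ ∈ 𝓝 z₀ := isOpen_Ioo.mem_nhds ⟨hz₀pos, hz₀ρ⟩
    filter_upwards [hmem] with s hs
    have habs : |s| = s := abs_of_pos hs.1
    have h := hagree s (by rw [habs]; exact hs.1) (by rw [habs]; exact hs.2)
    simp [hf_def, h]
  have hzero := hf.eqOn_zero_of_preconnected_of_eventuallyEq_zero isPreconnected_Icc hz₀U hev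
  intro t ht
  have h := hzero ht
  simpa [hf_def, sub_eq_zero] using h

/-! ## §3 Vitali with R0-shaped agreement, K1 and the leaf -/

/-- **The thermodynamic limit from `L`-uniformly bounded holomorphic extensions agreeing with the two-point function NEAR ZERO**: `β > 0`;
`Ω` open, preconnected, `0 ∈ Ω`; for `L ≥ L₀`, `G_L` complex differentiable on `Ω`, the family locally uniformly bounded uniformly in `L`,
and `G_L t = ⟨…⟩_{β,L,t,μ}` for `0 < |t| < ρ_L` (some `ρ_L > 0`); if the real segment `[0, U]` of the target coupling `U > 0` lies in `Ω`,
the finite-volume two-point functions at `U` converge as `L → ∞`. [folklore: Vitali–Porter + identity theorem] -/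
theorem tendsto_hubbardThermalTwoPoint_of_connected_extension_nearZero {β : ℝ} (hβ : 0 < β) (μ : ℝ) (x y : Site 2)
    (σ σ' : Fin 2) {Ω : Set ℂ} (hΩ : IsOpen Ω) (hΩc : IsPreconnected Ω) (h0 : (0 : ℂ) ∈ Ω) {G : ℕ → ℂ → ℂ} {L₀ : ℕ}
    (hd : ∀ L, L₀ ≤ L → DifferentiableOn ℂ (G L) Ω)
    (hb : ∀ a ∈ Ω, ∃ M : ℝ, ∃ r > 0, ∀ L, L₀ ≤ L → ∀ z ∈ ball a r ∩ Ω, ‖G L z‖ ≤ M)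
    (hagree : ∀ L, L₀ ≤ L → ∃ ρ : ℝ, 0 < ρ ∧ ∀ t : ℝ, 0 < |t| → |t| < ρ →
      G L (t : ℂ) = hubbardThermalTwoPoint β t μ L x y σ σ')
    {U : ℝ} (hU : 0 < U) (hseg : ∀ t ∈ Icc (0 : ℝ) U, ((t : ℝ) : ℂ) ∈ Ω) :
    ∃ S : ℂ, Tendsto (fun L : ℕ => hubbardThermalTwoPoint β U μ L x y σ σ') atTop (𝓝 S) := by
  -- agreement on the whole segment `[0, U]`, volume by volume
  have hsegAgree : ∀ L, L₀ ≤ L → ∀ t ∈ Icc (0 : ℝ) U, G L (t : ℂ) = hubbardThermalTwoPoint β t μ L x y σ σ' := by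
    intro L hL t ht
    obtain ⟨E, hEan, hEeq⟩ := exists_analyticAt_extension_hubbardThermalTwoPoint β μ L x y σ σ'
    obtain ⟨ρ, hρ, hρagree⟩ := hagree L hL
    have h := eqOn_segment_of_agree_near_zero hΩ (hd L hL) hEan hρ
      (fun s hs hs' => by rw [hρagree s hs hs', hEeq s]) hU hseg t ht
    rw [h, hEeq t]
  -- Vitali on the sub-domain: restrict the agreement hypothesis of the parent theorem to the segment by working on
  -- `Ω' := Ω`, with the real points of agreement taken on the segment: rerun the parent argument with the segment points
  set F : ℕ → ℂ → ℂ := fun k => G (k + L₀) with hF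
  have hF' : ∀ k, DifferentiableOn ℂ (F k) Ω := fun k => hd (k + L₀) (Nat.le_add_left _ _)
  have hb' : ∀ a ∈ Ω, ∃ M : ℝ, ∃ r > 0, ∀ k, ∀ z ∈ ball a r ∩ Ω, ‖F k z‖ ≤ M := by
    intro a ha
    obtain ⟨M, r, hr, hM⟩ := hb a ha
    exact ⟨M, r, hr, fun k z hz => hM (k + L₀) (Nat.le_add_left _ _) z hz⟩
  obtain ⟨r, hr, hconv⟩ := hubbardTwoPoint_limit_exists_of_small_coupling hβ μ
  have hr' : 0 < min r U := lt_min hr hU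
  -- real couplings `(min r U)/(m+2) → 0` within the punctured neighbourhood of `0`
  have hseq : Tendsto (fun m : ℕ => (((min r U / ((m : ℝ) + 2) : ℝ)) : ℂ)) atTop (𝓝[≠] (0 : ℂ)) := by
    apply tendsto_nhdsWithin_of_tendsto_nhds_of_eventually_within
    · have h1 : Tendsto (fun m : ℕ => (min r U / ((m : ℝ) + 2) : ℝ)) atTop (𝓝 0) := by
        apply Tendsto.div_atTop tendsto_const_nhds
        exact tendsto_atTop_add_const_right _ _ tendsto_natCast_atTop_atTop
      have h2 := (Complex.continuous_ofReal.tendsto 0).comp h1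
      simpa only [Function.comp_def, Complex.ofReal_zero] using h2
    · refine Eventually.of_forall fun m => ?_
      have hm : (0 : ℝ) < (m : ℝ) + 2 := by positivity
      have hne : (min r U / ((m : ℝ) + 2) : ℝ) ≠ 0 := (div_pos hr' hm).ne'
      simp only [mem_compl_iff, mem_singleton_iff]
      exact fun h => hne (Complex.ofReal_eq_zero.1 h)
  have hS : ∃ᶠ z in 𝓝[≠] (0 : ℂ), ∃ c : ℂ, Tendsto (fun k => F k z) atTop (𝓝 c) := by
    refine hseq.frequently (Eventually.of_forall fun m => ?_).frequently
    have hm : (0 : ℝ) < (m : ℝ) + 2 := by positivity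
    set Um : ℝ := min r U / ((m : ℝ) + 2) with hUm_def
    have hUm0 : 0 < Um := div_pos hr' hm
    have hUm_lt : Um < min r U := by
      rw [hUm_def, div_lt_iff₀ hm]
      nlinarith
    have hUr : |Um| < r := by rw [abs_of_pos hUm0]; exact hUm_lt.trans_le (min_le_left _ _)
    have hUseg : Um ∈ Icc (0 : ℝ) U := ⟨hUm0.le, (hUm_lt.trans_le (min_le_right _ _)).le⟩
    obtain ⟨S, hS⟩ := hconv _ hUr x y σ σ'
    refine ⟨S, ?_⟩
    have h2 := hS.comp (tendsto_add_atTop_nat L₀)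
    refine h2.congr fun k => ?_
    simp only [hF, Function.comp]
    exact (hsegAgree (k + L₀) (Nat.le_add_left _ _) Um hUseg).symm
  obtain ⟨f, -, hlim⟩ :=
    Literature.Analysis.Complex.exists_tendstoLocallyUniformlyOn_of_frequently_tendsto hΩ hΩc hF' hb' h0 hS
  refine ⟨f U, ?_⟩
  rw [← tendsto_add_atTop_iff_nat L₀]
  have hUΩ : ((U : ℝ) : ℂ) ∈ Ω := hseg U ⟨hU.le, le_rfl⟩
  refine (hlim.tendsto_at hUΩ).congr fun k => ?_
  exact hsegAgree (k + L₀) (Nat.le_add_left _ _) U ⟨hU.le, le_rfl⟩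

/-- **Crux K1 `H10TwoPointLimit` from the complex sausage, R0-shaped input**: `∃ U₀ a > 0` such that for every `μ` in the analysis window
`[-1, -0.15]`, every `β > 0`, sites and spins there are an open preconnected `Ω ∋ 0` containing the real SEGMENT `[0, U]` of every admissible
coupling (`0 < U ≤ U₀`, `β ≤ e^{a/U}`), `L₀`, a bound `B` and, for `L ≥ L₀`, holomorphic `G_L` on `Ω` with `‖G_L‖ ≤ B` there and
`G_L t = ⟨c†_{xσ} c_{yσ'}⟩_{β,L,t,μ}` for `0 < |t| < ρ_L` (some `ρ_L > 0`) ⟹ K1. [cite: BenfattoGiulianiMastropietro2006, Thm 1.1 / §2.2 footnote 1] -/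
theorem H10TwoPointLimit_of_complexSausage_nearZero {U₀ a : ℝ} (hU₀ : 0 < U₀) (ha : 0 < a)
    (h : ∀ μ ∈ Set.Icc (-1 : ℝ) (-0.15), ∀ β : ℝ, 0 < β → ∀ (x y : Site 2) (σ σ' : Fin 2),
      ∃ Ω : Set ℂ, IsOpen Ω ∧ IsPreconnected Ω ∧ (0 : ℂ) ∈ Ω ∧
        (∀ U : ℝ, 0 < U → U ≤ U₀ → β ≤ Real.exp (a / U) → ∀ t ∈ Icc (0 : ℝ) U, ((t : ℝ) : ℂ) ∈ Ω) ∧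
        ∃ (L₀ : ℕ) (B : ℝ) (G : ℕ → ℂ → ℂ), (∀ L, L₀ ≤ L → DifferentiableOn ℂ (G L) Ω) ∧
          (∀ L, L₀ ≤ L → ∀ z ∈ Ω, ‖G L z‖ ≤ B) ∧
          (∀ L, L₀ ≤ L → ∃ ρ : ℝ, 0 < ρ ∧ ∀ t : ℝ, 0 < |t| → |t| < ρ →
            G L (t : ℂ) = hubbardThermalTwoPoint β t μ L x y σ σ')) :
    Summit.HubbardSuperconductivity.HubbardSuperconductivity.Theses.KLProgramme.H10TwoPointLimit := by
  refine ⟨U₀, a, hU₀, ha, fun δ hδ U β hU hUle hβ hβa x y σ σ' => ?_⟩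
  have hμ := Summit.HubbardSuperconductivity.HubbardSuperconductivity.Theses.KLProgramme.MuOfDopingWindow_holds δ hδ
  obtain ⟨Ω, hΩ, hΩc, h0, hadm, L₀, B, G, hd, hB, hagree⟩ := h _ hμ β hβ x y σ σ'
  exact tendsto_hubbardThermalTwoPoint_of_connected_extension_nearZero hβ _ x y σ σ' hΩ hΩc h0 hd
    (fun _ _ => ⟨B, 1, one_pos, fun L hL z hz => hB L hL z hz.2⟩) hagree hU (hadm U hU hUle hβa)

/-- **The rung-R2d leaf `H1TwoPointLimitKLScaleD` from the complex sausage, R0-shaped input** (admissible = `0 < U ≤ U₀`,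
`0 < β ≤ e^{c/U²}`). [cite: BenfattoGiulianiMastropietro2006, Thm 1.1 / §2.2 footnote 1] -/
theorem leaf_of_complexSausage_nearZero {U₀ c : ℝ} (hU₀ : 0 < U₀) (hc : 0 < c)
    (h : ∀ μ ∈ Set.Icc (-1 : ℝ) (-0.15), ∀ β : ℝ, 0 < β → ∀ (x y : Site 2) (σ σ' : Fin 2),
      ∃ Ω : Set ℂ, IsOpen Ω ∧ IsPreconnected Ω ∧ (0 : ℂ) ∈ Ω ∧
        (∀ U : ℝ, 0 < U → U ≤ U₀ → β ≤ Real.exp (c / U ^ 2) → ∀ t ∈ Icc (0 : ℝ) U, ((t : ℝ) : ℂ) ∈ Ω) ∧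
        ∃ (L₀ : ℕ) (B : ℝ) (G : ℕ → ℂ → ℂ), (∀ L, L₀ ≤ L → DifferentiableOn ℂ (G L) Ω) ∧
          (∀ L, L₀ ≤ L → ∀ z ∈ Ω, ‖G L z‖ ≤ B) ∧
          (∀ L, L₀ ≤ L → ∃ ρ : ℝ, 0 < ρ ∧ ∀ t : ℝ, 0 < |t| → |t| < ρ →
            G L (t : ℂ) = hubbardThermalTwoPoint β t μ L x y σ σ')) :
    Summit.HubbardSuperconductivity.HubbardSuperconductivity.Theses.WeakCouplingBCS.H1TwoPointLimitKLScaleD := by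
  refine ⟨U₀, c, hU₀, hc, fun δ hδ U β hU hUle hβ hβc x y σ σ' => ?_⟩
  have hμ := Summit.HubbardSuperconductivity.HubbardSuperconductivity.Theses.KLProgramme.MuOfDopingWindow_holds δ hδ
  obtain ⟨Ω, hΩ, hΩc, h0, hadm, L₀, B, G, hd, hB, hagree⟩ := h _ hμ β hβ x y σ σ'
  exact tendsto_hubbardThermalTwoPoint_of_connected_extension_nearZero hβ _ x y σ σ' hΩ hΩc h0 hd
    (fun _ _ => ⟨B, 1, one_pos, fun L hL z hz => hB L hL z hz.2⟩) hagree hU (hadm U hU hUle hβc)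

/-! ## §4 (appended) The Vitali line eats the tree's R0-core output raw: a DISC of `L`-uniform analyticity about `0`

The tree's rung-R0 pipeline (`…Theorems.KLProgrammeH10RungBetaUCorner`: `R0_core` ⟹ `truncatedCoeff_bound_of_extension` (Cauchy
estimates) ⟹ `tendsto_hubbardThermalTwoPoint_of_truncated_bounds` + `termwise_limit_hubbardTorusTruncatedCoeff` (the order-by-order
thermodynamic limit)) turns «for all large `L`, a `G_L` complex differentiable on `|u| < R`, continuous on the closed disc, bounded by `M` on
`|u| = R`, agreeing with the two-point function at `0 < |U| < ρ_L`» into the limit for real `|U| < R`.  The SAME input gives the same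
conclusion by Vitali–Porter alone (maximum modulus puts the sphere bound inside the disc; the disc is connected and contains `[0, U]`):
so an engine delivering R0-core-shaped output on a connected region reaching `U₀ ∧ a/log β` closes K1 through
`H10TwoPointLimit_of_complexSausage_nearZero` with no further assembly. -/

/-- **The thermodynamic limit inside a disc of `L`-uniform analyticity about `0`** (R0-core-shaped input, consumed by Vitali–Porter):
for `β > 0` and `R > 0`, if for all large `L` there are `G_L`, complex differentiable on `|u| < R` and continuous on the closed disc, bounded
by `M` on the circle `|u| = R`, with `G_L U = ⟨c†_{xσ} c_{yσ'}⟩_{β,L,U,μ}` for `0 < |U| < ρ_L` (some `ρ_L > 0`), then for every real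
`0 < U < R` the finite-volume two-point functions converge as `L → ∞`. [folklore: Vitali–Porter + maximum modulus] -/
theorem tendsto_hubbardThermalTwoPoint_of_disc_extension {β : ℝ} (hβ : 0 < β) (μ : ℝ) (x y : Site 2) (σ σ' : Fin 2)
    {R M : ℝ} (hR : 0 < R)
    (hext : ∀ᶠ L : ℕ in atTop, ∃ (G : ℂ → ℂ) (ρ : ℝ), 0 < ρ ∧ DiffContOnCl ℂ G (ball 0 R) ∧
      (∀ z ∈ sphere (0 : ℂ) R, ‖G z‖ ≤ M) ∧
      ∀ U : ℝ, 0 < |U| → |U| < ρ → G (U : ℂ) = hubbardThermalTwoPoint β U μ L x y σ σ')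
    {U : ℝ} (hU0 : 0 < U) (hUR : U < R) :
    ∃ S : ℂ, Tendsto (fun L : ℕ => hubbardThermalTwoPoint β U μ L x y σ σ') atTop (𝓝 S) := by
  obtain ⟨L₀, hL₀⟩ := eventually_atTop.1 hext
  choose G ρ hρ hG hM hagree using hL₀
  -- a total family, equal to the given extensions for `L ≥ L₀`
  set G' : ℕ → ℂ → ℂ := fun L => if h : L₀ ≤ L then G L h else 0 with hG'_def
  have hG'eq : ∀ L (h : L₀ ≤ L), G' L = G L h := fun L h => by simp [hG'_def, h]
  refine tendsto_hubbardThermalTwoPoint_of_connected_extension_nearZero hβ μ x y σ σ' (Ω := ball (0 : ℂ) R)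
    isOpen_ball (convex_ball (0 : ℂ) R).isPreconnected (mem_ball_self hR) (G := G') (L₀ := L₀) ?_ ?_ ?_ hU0 ?_
  · intro L hL
    rw [hG'eq L hL]
    exact (hG L hL).differentiableOn
  · -- maximum modulus: the sphere bound holds in the whole disc
    intro a ha
    refine ⟨M, 1, one_pos, fun L hL z hz => ?_⟩
    rw [hG'eq L hL]
    refine Complex.norm_le_of_forall_mem_frontier_norm_le isBounded_ball (hG L hL) (fun w hw => hM L hL w ?_)
      (subset_closure hz.2)
    rwa [frontier_ball (0 : ℂ) hR.ne'] at hw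
  · intro L hL
    exact ⟨ρ L hL, hρ L hL, fun t ht ht' => by rw [hG'eq L hL]; exact hagree L hL t ht ht'⟩
  · intro t ht
    rw [mem_ball, dist_zero_right, Complex.norm_real, Real.norm_eq_abs, abs_of_nonneg ht.1]
    exact lt_of_le_of_lt ht.2 hUR

/-- **The same on a `μ`-window with a temperature-dependent radius `R β`**: if for every `μ` in the window, every `β ≥ β₀` and all sites/spins
the R0-core-shaped input holds on the disc `|u| < R β`, then the limit exists for every `β ≥ β₀` and every real `0 < U < R β` — e.g. with
`R β = κ/β` (the tree's `R0_core`) this is the `βU`-corner `0 < U`, `βU < κ`, now WITHOUT the order-by-order thermodynamic limit.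
[folklore: composition] -/
theorem limit_on_window_of_disc_extension {μa μb β₀ : ℝ} {R : ℝ → ℝ} (hRpos : ∀ β, β₀ ≤ β → 0 < R β)
    (h : ∀ β : ℝ, β₀ ≤ β → 0 < β → ∀ μ ∈ Set.Icc μa μb, ∀ (x y : Site 2) (σ σ' : Fin 2), ∃ M : ℝ,
      ∀ᶠ L : ℕ in atTop, ∃ (G : ℂ → ℂ) (ρ : ℝ), 0 < ρ ∧ DiffContOnCl ℂ G (ball 0 (R β)) ∧
        (∀ z ∈ sphere (0 : ℂ) (R β), ‖G z‖ ≤ M) ∧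
        ∀ U : ℝ, 0 < |U| → |U| < ρ → G (U : ℂ) = hubbardThermalTwoPoint β U μ L x y σ σ') :
    ∀ β : ℝ, β₀ ≤ β → 0 < β → ∀ μ ∈ Set.Icc μa μb, ∀ U : ℝ, 0 < U → U < R β →
      ∀ (x y : Site 2) (σ σ' : Fin 2), ∃ S : ℂ,
        Tendsto (fun L : ℕ => hubbardThermalTwoPoint β U μ L x y σ σ') atTop (𝓝 S) := by
  intro β hβ₀ hβ μ hμ U hU0 hUR x y σ σ'
  obtain ⟨M, hM⟩ := h β hβ₀ hβ μ hμ x y σ σ'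
  exact tendsto_hubbardThermalTwoPoint_of_disc_extension hβ μ x y σ σ' (hRpos β hβ₀) hM hU0 hUR

/-! ## §5 (appended) The weakest landed form of the stub: LOCAL uniform bounds (engines whose constants degrade at `∂Ω`) -/

/-- **Crux K1 `H10TwoPointLimit` from the complex sausage with LOCALLY uniform bounds and R0-shaped agreement** — the most permissive
landed form of the Vitali line's one input: for every `μ` in the analysis window, `β > 0`, sites/spins, an open preconnected `Ω ∋ 0`
containing the real segment `[0, U]` of every admissible coupling (`0 < U ≤ U₀`, `β ≤ e^{a/U}`), `L₀` and holomorphic `G_L` (`L ≥ L₀`) on `Ω`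
that are uniformly bounded NEAR EACH POINT of `Ω` (bound and radius may depend on the point, not on `L`) and agree with
`t ↦ ⟨c†_{xσ} c_{yσ'}⟩_{β,L,t,μ}` at `0 < |t| < ρ_L`. [cite: BenfattoGiulianiMastropietro2006, Thm 1.1 / §2.2 footnote 1] -/
theorem H10TwoPointLimit_of_complexSausage_local {U₀ a : ℝ} (hU₀ : 0 < U₀) (ha : 0 < a)
    (h : ∀ μ ∈ Set.Icc (-1 : ℝ) (-0.15), ∀ β : ℝ, 0 < β → ∀ (x y : Site 2) (σ σ' : Fin 2),
      ∃ Ω : Set ℂ, IsOpen Ω ∧ IsPreconnected Ω ∧ (0 : ℂ) ∈ Ω ∧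
        (∀ U : ℝ, 0 < U → U ≤ U₀ → β ≤ Real.exp (a / U) → ∀ t ∈ Icc (0 : ℝ) U, ((t : ℝ) : ℂ) ∈ Ω) ∧
        ∃ (L₀ : ℕ) (G : ℕ → ℂ → ℂ), (∀ L, L₀ ≤ L → DifferentiableOn ℂ (G L) Ω) ∧
          (∀ z ∈ Ω, ∃ M : ℝ, ∃ r > 0, ∀ L, L₀ ≤ L → ∀ w ∈ ball z r ∩ Ω, ‖G L w‖ ≤ M) ∧
          (∀ L, L₀ ≤ L → ∃ ρ : ℝ, 0 < ρ ∧ ∀ t : ℝ, 0 < |t| → |t| < ρ →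
            G L (t : ℂ) = hubbardThermalTwoPoint β t μ L x y σ σ')) :
    Summit.HubbardSuperconductivity.HubbardSuperconductivity.Theses.KLProgramme.H10TwoPointLimit := by
  refine ⟨U₀, a, hU₀, ha, fun δ hδ U β hU hUle hβ hβa x y σ σ' => ?_⟩
  have hμ := Summit.HubbardSuperconductivity.HubbardSuperconductivity.Theses.KLProgramme.MuOfDopingWindow_holds δ hδ
  obtain ⟨Ω, hΩ, hΩc, h0, hadm, L₀, G, hd, hb, hagree⟩ := h _ hμ β hβ x y σ σ'
  exact tendsto_hubbardThermalTwoPoint_of_connected_extension_nearZero hβ _ x y σ σ' hΩ hΩc h0 hd hb hagree hU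
    (hadm U hU hUle hβa)

/-- **The rung-R2d leaf from the complex sausage with LOCALLY uniform bounds and R0-shaped agreement** (admissible = `0 < U ≤ U₀`,
`0 < β ≤ e^{c/U²}`). [cite: BenfattoGiulianiMastropietro2006, Thm 1.1 / §2.2 footnote 1] -/
theorem leaf_of_complexSausage_local {U₀ c : ℝ} (hU₀ : 0 < U₀) (hc : 0 < c)
    (h : ∀ μ ∈ Set.Icc (-1 : ℝ) (-0.15), ∀ β : ℝ, 0 < β → ∀ (x y : Site 2) (σ σ' : Fin 2),
      ∃ Ω : Set ℂ, IsOpen Ω ∧ IsPreconnected Ω ∧ (0 : ℂ) ∈ Ω ∧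
        (∀ U : ℝ, 0 < U → U ≤ U₀ → β ≤ Real.exp (c / U ^ 2) → ∀ t ∈ Icc (0 : ℝ) U, ((t : ℝ) : ℂ) ∈ Ω) ∧
        ∃ (L₀ : ℕ) (G : ℕ → ℂ → ℂ), (∀ L, L₀ ≤ L → DifferentiableOn ℂ (G L) Ω) ∧
          (∀ z ∈ Ω, ∃ M : ℝ, ∃ r > 0, ∀ L, L₀ ≤ L → ∀ w ∈ ball z r ∩ Ω, ‖G L w‖ ≤ M) ∧
          (∀ L, L₀ ≤ L → ∃ ρ : ℝ, 0 < ρ ∧ ∀ t : ℝ, 0 < |t| → |t| < ρ →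
            G L (t : ℂ) = hubbardThermalTwoPoint β t μ L x y σ σ')) :
    Summit.HubbardSuperconductivity.HubbardSuperconductivity.Theses.WeakCouplingBCS.H1TwoPointLimitKLScaleD := by
  refine ⟨U₀, c, hU₀, hc, fun δ hδ U β hU hUle hβ hβc x y σ σ' => ?_⟩
  have hμ := Summit.HubbardSuperconductivity.HubbardSuperconductivity.Theses.KLProgramme.MuOfDopingWindow_holds δ hδ
  obtain ⟨Ω, hΩ, hΩc, h0, hadm, L₀, G, hd, hb, hagree⟩ := h _ hμ β hβ x y σ σ'
  exact tendsto_hubbardThermalTwoPoint_of_connected_extension_nearZero hβ _ x y σ σ' hΩ hΩc h0 hd hb hagree hU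
    (hadm U hU hUle hβc)

/-! ## §6 (appended) The engine-level input: a MATSUBARA-INDEXED family bounded on the sausage (Montel in `M`, `…MatsubaraExtension`) -/

/-- **Crux K1 `H10TwoPointLimit` from a Matsubara-indexed family bounded on the complex sausage** — the form in which the tree's
complex-coupling engine (`HubbardBetaUBound.norm_hubbardRatio_le_betaUMb` on the disc) states its output: for every `μ` in the window, `β > 0`,
sites/spins: an open preconnected `Ω ∋ 0` ⊇ the segments `[0, U]` of the admissible couplings (`0 < U ≤ U₀`, `β ≤ e^{a/U}`), constants `B, C`,
a threshold `L₀`, and for each `L ≥ L₀`: `M₀`, a constant `c` with `‖c‖ ≤ C` (the Grassmann ratio's `½` on the diagonal), `ρ > 0` and `g_M`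
(`M ≥ M₀`) holomorphic on `Ω`, `‖g_M‖ ≤ B`, with `g_M(t) → ⟨…⟩_{β,L,t,μ} − c` at the real `0 < |t| < ρ` in `Ω`.
[cite: BenfattoGiulianiMastropietro2006, Thm 2.1 / §2.2 footnote 1] -/
theorem H10TwoPointLimit_of_matsubaraSausage {U₀ a : ℝ} (hU₀ : 0 < U₀) (ha : 0 < a)
    (h : ∀ μ ∈ Set.Icc (-1 : ℝ) (-0.15), ∀ β : ℝ, 0 < β → ∀ (x y : Site 2) (σ σ' : Fin 2),
      ∃ Ω : Set ℂ, IsOpen Ω ∧ IsPreconnected Ω ∧ (0 : ℂ) ∈ Ω ∧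
        (∀ U : ℝ, 0 < U → U ≤ U₀ → β ≤ Real.exp (a / U) → ∀ t ∈ Icc (0 : ℝ) U, ((t : ℝ) : ℂ) ∈ Ω) ∧
        ∃ (B C : ℝ) (L₀ : ℕ), ∀ L : ℕ, L₀ ≤ L →
          ∃ (M₀ : ℕ) (c : ℂ) (ρ : ℝ) (g : ℕ → ℂ → ℂ), ‖c‖ ≤ C ∧ 0 < ρ ∧
            (∀ M, M₀ ≤ M → DifferentiableOn ℂ (g M) Ω) ∧ (∀ M, M₀ ≤ M → ∀ z ∈ Ω, ‖g M z‖ ≤ B) ∧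
            (∀ t : ℝ, 0 < |t| → |t| < ρ → ((t : ℝ) : ℂ) ∈ Ω →
              Tendsto (fun M : ℕ => g M (t : ℂ)) atTop (𝓝 (hubbardThermalTwoPoint β t μ L x y σ σ' - c)))) :
    Summit.HubbardSuperconductivity.HubbardSuperconductivity.Theses.KLProgramme.H10TwoPointLimit := by
  refine H10TwoPointLimit_of_complexSausage_nearZero hU₀ ha fun μ hμ β hβ x y σ σ' => ?_
  obtain ⟨Ω, hΩ, hΩc, h0, hadm, B, C, L₀, hL⟩ := h μ hμ β hβ x y σ σ'
  have hG : ∀ L, L₀ ≤ L → ∃ G : ℂ → ℂ, DifferentiableOn ℂ G Ω ∧ (∀ z ∈ Ω, ‖G z‖ ≤ B + C) ∧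
      ∃ ρ' : ℝ, 0 < ρ' ∧ ∀ t : ℝ, 0 < |t| → |t| < ρ' → G (t : ℂ) = hubbardThermalTwoPoint β t μ L x y σ σ' := by
    intro L hLL
    obtain ⟨M₀, c, ρ, g, hc, hρ, hg, hgB, hlim⟩ := hL L hLL
    obtain ⟨G, hGd, hGB, ρ', hρ', hagree⟩ := extension_of_matsubara_family hΩ h0 hρ hg hgB hlim
    exact ⟨G, hGd, fun z hz => (hGB z hz).trans (by linarith), ρ', hρ', hagree⟩
  choose G hGd hGB ρ' hρ' hagree using hG
  refine ⟨Ω, hΩ, hΩc, h0, hadm, L₀, B + C, fun L => if hL' : L₀ ≤ L then G L hL' else 0, ?_, ?_, ?_⟩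
  · intro L hLL; simp only [hLL, ↓reduceDIte]; exact hGd L hLL
  · intro L hLL z hz; simp only [hLL, ↓reduceDIte]; exact hGB L hLL z hz
  · intro L hLL; simp only [hLL, ↓reduceDIte]; exact ⟨ρ' L hLL, hρ' L hLL, hagree L hLL⟩

/-- **The rung-R2d leaf from a Matsubara-indexed family bounded on the complex sausage** (admissible = `0 < U ≤ U₀`, `0 < β ≤ e^{c₀/U²}`).
[cite: BenfattoGiulianiMastropietro2006, Thm 2.1 / §2.2 footnote 1] -/
theorem leaf_of_matsubaraSausage {U₀ c₀ : ℝ} (hU₀ : 0 < U₀) (hc₀ : 0 < c₀)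
    (h : ∀ μ ∈ Set.Icc (-1 : ℝ) (-0.15), ∀ β : ℝ, 0 < β → ∀ (x y : Site 2) (σ σ' : Fin 2),
      ∃ Ω : Set ℂ, IsOpen Ω ∧ IsPreconnected Ω ∧ (0 : ℂ) ∈ Ω ∧
        (∀ U : ℝ, 0 < U → U ≤ U₀ → β ≤ Real.exp (c₀ / U ^ 2) → ∀ t ∈ Icc (0 : ℝ) U, ((t : ℝ) : ℂ) ∈ Ω) ∧
        ∃ (B C : ℝ) (L₀ : ℕ), ∀ L : ℕ, L₀ ≤ L →
          ∃ (M₀ : ℕ) (c : ℂ) (ρ : ℝ) (g : ℕ → ℂ → ℂ), ‖c‖ ≤ C ∧ 0 < ρ ∧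
            (∀ M, M₀ ≤ M → DifferentiableOn ℂ (g M) Ω) ∧ (∀ M, M₀ ≤ M → ∀ z ∈ Ω, ‖g M z‖ ≤ B) ∧
            (∀ t : ℝ, 0 < |t| → |t| < ρ → ((t : ℝ) : ℂ) ∈ Ω →
              Tendsto (fun M : ℕ => g M (t : ℂ)) atTop (𝓝 (hubbardThermalTwoPoint β t μ L x y σ σ' - c)))) :
    Summit.HubbardSuperconductivity.HubbardSuperconductivity.Theses.WeakCouplingBCS.H1TwoPointLimitKLScaleD := by
  refine leaf_of_complexSausage_nearZero hU₀ hc₀ fun μ hμ β hβ x y σ σ' => ?_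
  obtain ⟨Ω, hΩ, hΩc, h0, hadm, B, C, L₀, hL⟩ := h μ hμ β hβ x y σ σ'
  have hG : ∀ L, L₀ ≤ L → ∃ G : ℂ → ℂ, DifferentiableOn ℂ G Ω ∧ (∀ z ∈ Ω, ‖G z‖ ≤ B + C) ∧
      ∃ ρ' : ℝ, 0 < ρ' ∧ ∀ t : ℝ, 0 < |t| → |t| < ρ' → G (t : ℂ) = hubbardThermalTwoPoint β t μ L x y σ σ' := by
    intro L hLL
    obtain ⟨M₀, c, ρ, g, hc, hρ, hg, hgB, hlim⟩ := hL L hLL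
    obtain ⟨G, hGd, hGB, ρ', hρ', hagree⟩ := extension_of_matsubara_family hΩ h0 hρ hg hgB hlim
    exact ⟨G, hGd, fun z hz => (hGB z hz).trans (by linarith), ρ', hρ', hagree⟩
  choose G hGd hGB ρ' hρ' hagree using hG
  refine ⟨Ω, hΩ, hΩc, h0, hadm, L₀, B + C, fun L => if hL' : L₀ ≤ L then G L hL' else 0, ?_, ?_, ?_⟩
  · intro L hLL; simp only [hLL, ↓reduceDIte]; exact hGd L hLL
  · intro L hLL z hz; simp only [hLL, ↓reduceDIte]; exact hGB L hLL z hz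
  · intro L hLL; simp only [hLL, ↓reduceDIte]; exact ⟨ρ' L hLL, hρ' L hLL, hagree L hLL⟩

end Summit.HubbardSuperconductivity.HubbardSuperconductivity.Theorems.H10VitaliLine

end
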